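import Summits.Ventures.Crystal3D.Theorems.StickyWulffConstantTextureLiminfTexShadowCertificateDefs
import Summits.Ventures.Crystal3D.Bulk.LocalTwelve
import HarnessLib

/-!
# TexShadow §2 — the MESOSCOPIC BARLOW RESOLUTION vocabulary, VERBATIM, and the cube-rigidity interface of `stub_resolution`
# (lane T, crux `TextureLiminf`, stmt-Ventures-19483; registered line `TexShadow` v6.12, stub `stub_resolution` [L])

HONEST FRAMING. Venture `Summits/Ventures/Crystal3D` (cell `crystal3d-full`), helper `--supports` the crux
`TextureLiminf` (stmt-Ventures-19483) of `route-Ventures-StickyWulffConstant`, registered line `TexShadow`.  Rung credit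
only; F-C1 not moved.  DEFINITIONS ONLY; nothing is claimed about the stub.

`cube` and `BarlowResolution` are the tree copies (byte-identical declarations, same namespace) of the planner's skeleton §2
(HOME/cf-p1/route/lines/tex/TexShadow.lean v6.12), so that the proof of `stub_resolution : L12Local → BarlowResolution` can live
under `Theorems/` and a later skeleton version imports them.  `CubeRigidity` is NEW: the purely geometric core of that proof,
isolated as one named statement — for every cube side `M ≥ 1` a margin `D` such that, in every unit packing, a cube all of whose
`D`-neighbourhood balls have close-packed first shells has all ITS balls on ONE moved Barlow stacking.  The reduction
`L12Local → CubeRigidity → BarlowResolution` (counting: `card_le_of_localTwelve`, grid cubes, a packing count around each defective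
ball) is `…TextureLiminfResolutionOfRigidity`; `CubeRigidity` itself (layer completeness of hcp-type balls, uniqueness of their
normal, single-lattice rigidity of fcc-type components through radius-2 patches `radiusTwoBarlow_holds`, exclusion of two
non-parallel complete layers near the cube, assembly of `(L, s, σ)`) is the multi-file sequel.
WHAT THIS IS NOT: no proof of `stub_resolution`; F-C1 not moved.
-/

noncomputable section

namespace Summit.Ventures.Crystal3D.Cruxes.TextureLiminf.TexShadow

open Summit.Ventures.Crystal3D
open Literature.MathematicalPhysics.StatisticalMechanics (IsHaggSeq)

/-- the half-open axis-parallel cube of side `M` with lower corner `q`. -/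
def cube (q : E3) (M : ℝ) : Set E3 := {p | ∀ t : Fin 3, q t ≤ p t ∧ p t < q t + M}

open scoped Classical in
/-- **Mesoscopic Barlow resolution** of a near-optimal cluster (v6, INCLUSION form): pairwise disjoint cubes of
side `M` on each of which every ball lies on ONE moved Barlow stacking (vacant sites allowed: internal vacancies
and the rough cluster surface stay in the grain — the tent pays for exactly the bonds they break), capturing all
but `δN` balls, for `N ≥ N₀(K, δ, M)`.  v5's exact-coincidence form implies this one. -/
def BarlowResolution : Prop :=
  ∀ K δ M : ℝ, 0 < δ → 1 ≤ M → ∃ N₀ : ℕ, ∀ N : ℕ, N₀ ≤ N → ∀ x : Fin N → E3, IsUnitPacking x →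
    6 * (N : ℝ) - (numContacts x : ℝ) ≤ K * (N : ℝ) ^ ((2 : ℝ) / 3) →
    ∃ (J : ℕ) (q : Fin J → E3) (L : Fin J → (E3 ≃ₗᵢ[ℝ] E3)) (s : Fin J → E3) (σ : Fin J → ℤ → ℤ),
      (∀ j, IsHaggSeq (σ j)) ∧
      (∀ j j', j ≠ j' → Disjoint (cube (q j) M) (cube (q j') M)) ∧
      (∀ j, ∀ p ∈ cube (q j) M, p ∈ Set.range x → p ∈ stacking (L j) (s j) (σ j)) ∧
      (1 - δ) * (N : ℝ) ≤ ((Finset.univ.filter fun i => ∃ j, x i ∈ cube (q j) M).card : ℝ)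

/-- **CUBE RIGIDITY** (the geometric core of `stub_resolution`, NEW named statement): for every side `M ≥ 1` there is a margin
`D ≥ 0` such that in every finite packing of unit-diameter balls in `ℝ³` and for every cube `cube q M`: if EVERY ball in the
sup-norm `D`-neighbourhood `{p | ∀ t, q t − D ≤ p t ≤ q t + M + D}` of the cube has a close-packed (fcc- or hcp-type) first shell,
then all balls IN the cube lie on ONE moved Barlow stacking `stacking L s σ` (some frame, origin and Hägg word).  Why true: inside a
defect-free region hcp-type balls come in COMPLETE basal layers with a unique normal; two non-parallel complete layers both meeting
the cube would meet within `√3M / sin 70.5° < 2M` of it and put two balls closer than `1`; fcc-type components are single lattice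
cosets (13-ball rigidity through radius-2 patches) bordering those layers; so every ball near the cube has a complete hexagon ⊥ the
common normal and three nested neighbours above and below — one stacking.  `D = 8M + 8` suffices (two fault families cutting
different corners of the cube must meet or terminate within `7.3M`). -/
def CubeRigidity : Prop :=
  ∀ M : ℝ, 1 ≤ M → ∃ D : ℝ, 0 ≤ D ∧ ∀ (N : ℕ) (x : Fin N → E3), IsUnitPacking x → ∀ q : E3,
    (∀ i : Fin N, (∀ t : Fin 3, q t - D ≤ x i t ∧ x i t ≤ q t + M + D) → IsClosePackedShell x i) →
    ∃ (L : E3 ≃ₗᵢ[ℝ] E3) (s : E3) (σ : ℤ → ℤ), IsHaggSeq σ ∧ ∀ i : Fin N, x i ∈ cube q M → x i ∈ stacking L s σ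

end Summit.Ventures.Crystal3D.Cruxes.TextureLiminf.TexShadow

end
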